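import Summits.QuantumFields.YangMills.Theorems.BalabanLadderIRTwistCostOfPurity
import Summits.QuantumFields.YangMills.Theorems.BalabanLadderIRAfOnsetCovariance
import HarnessLib

/-!
# Crux `IRcof` (stmt-QuantumFields-26930) — LINE «running-landmark» (ideator ym-ir-idea-24 g0, lens `recomb2`): VOCABULARY and
# STATEMENTS as tree constants (definition lane; nothing is claimed)

Helper module for `Summit.QuantumFields.YangMills.Theses.BalabanLadder.IRcof` (stmt-QuantumFields-26930; `--supports … --as helper`, it
closes nothing).  The route-posited objects of the line «running-landmark» — workfile `Cruxes/IRcof/Lines/running_landmark.lean`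
(crux write 4ce0ec1369f2, tree sha16 81d9d3aed4c37d82; critic ym-ir-crit-3 g3 `VERDICT-running-landmark-idea24-crit3-g3.md`
2026-08-28T20:34Z: PASS-WITH-PRICE, census row 48, «KEY (№34): ONE helper — prove `stub_pin` (J) … which means the defs
`twistRatio/ThawedAt/FrozenBelow/torusCov/RunningWindow/HyperscalingEnvelope/PinnedThaw` first move to a def-only Theorems file
(definition lane) so a Theorems proof can import them») — made tree constants VERBATIM (§0 vocabulary with its four elementary
lemmas, the torus covariance `torusCov` with `Q2_eq_sum_torusCov`, §1 the six statement `Prop`s of the cut), so that (i) the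
junction lemma (J) `stub_pin : RunningWindow → HyperscalingEnvelope → PinnedThaw` can be proved in a `Theorems/` file BY NAME
(`Theorems/BalabanLadderIRcofRunningLandmarkPin.lean`, pool-p3) and (ii) the workfile re-bases on `import` + deletion.  The statements
are the workfile's, byte-for-byte; the stubs themselves are NOT here; NOTHING below the `def`s is asserted except the four small lemmas
(`thawedAt_mono`, `frozenBelow_mono`, `twistRatio_pos`, `twistRatio_le_one`, `thawedAt_of_pure`, `centre_trivial_of_no_twist` — all
PROVED from the tree's twist domination ∕ S1 `TwistCost.half_twist_cost_le_coldDefect`).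

THE LINE IN ONE SENTENCE (card `Cruxes/IRcof/Lines/running-landmark.md`): PXcof(1∕24) ⇐ (EP) purity within `T(η)` twist-THAW landmarks,
cofinally (floor-free, unit-free — the infrared content re-coordinatised, width 0, declared) ∧ (J) the floor `LowerBounds G r a` pins an
`η`-thaw within `R` floor-units ⇐ (RW) asymptotic freedom on the frozen window in twisted-coupling form [UV-class] ∧ (H) the hyperscaling
envelope [soft NP] ∧ (CF) the centre-free residual; N_cof by name.  The `def … : Prop` below are line statements (hypotheses of the
cut), not literature facts and not claims.

HONEST FRAMING: vocabulary for a CONDITIONAL reduction of the junior binder `IRcof` of a CONDITIONAL chain; (EP) carries the infrared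
content (confinement + gap + asymptotic scaling in one currency), (RW) is constructive-UV content, (H) is open; nothing here proves PXcof,
`IRcof`, `IR`, confinement, a lattice gap or the Yang–Mills mass gap (Clay) — NOT proved; R4 closes only the conditional finite-𝕋⁴ rung
`BalabanLadder.UV`.  Refs: 't Hooft, NPB 153 (1979) §5; de Divitiis–Frezzotti–Guagnelli–Petronzio, NPB 422 (1994); Lüscher–Sommer–
Weisz–Wolff, NPB 413 (1994); the tree's `TwistCost.*` (p611125 ∕ p613382) and `AfOnset.*` (parent family A).
-/

set_option autoImplicit false

noncomputable section

open Filter Topology MeasureTheory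
open scoped SchwartzMap
open Literature.MathematicalPhysics.QuantumFieldTheory Literature.MathematicalPhysics.QuantumLattice
open Literature.Probability.LatticeModels (Site)
open Summit.QuantumFields.YangMills.Cruxes.OSLegsFromFemtoAndGap.DlrCollarTransfer (LowerBounds torusE dens Q2)
open Summit.QuantumFields.YangMills.Cruxes.IR.ColdPurityBridge (coldDefect)
open Summit.QuantumFields.YangMills.Cruxes.IR.TwistCost (twistedPartition_le half_twist_cost_le_coldDefect)

namespace Summit.QuantumFields.YangMills.Cruxes.IRcof.RunningLandmark

/-! ## §0 Vocabulary: the twist ratio of the cold box, thaw, freeze; the torus covariance of action densities -/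

section Vocabulary

variable {G : Type} [Group G] [TopologicalSpace G] [IsTopologicalGroup G] [CompactSpace G]
  [MeasurableSpace G] [BorelSpace G] {N : ℕ}

/-- A NONTRIVIAL CENTRAL TEMPORAL TWIST DATUM: `z μ ∈ Z(G)` for all `μ`, and `z` is nontrivial in at least one of the three temporal planes
`(μ, 3)`, `μ < 3` (the slot `z 3` is never read by `wilsonFinTorusTwistedPartition`). -/
def IsCentralTwist (z : Fin 4 → G) : Prop :=
  (∀ μ, z μ ∈ Subgroup.center G) ∧ ∃ i : Fin 3, z i.castSucc ≠ 1

/-- **Twist ratio of the cold `4:1` box** `L³ × ⌊L∕4⌋`: `r_z(β, L) = Z^{(z)} ∕ Z ∈ (0, 1]` for central `z` (`twistRatio_pos`, `twistRatio_le_one`).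
`−log r_z` is 't Hooft's electric-flux (twist) free energy; `s_cl ∕ (−log r_z)` is the twisted finite-volume running coupling. -/
def twistRatio (ρ : G →* Matrix (Fin N) (Fin N) ℂ) (β : ℝ) (z : Fin 4 → G) (L : ℕ) : ℝ :=
  wilsonFinTorusTwistedPartition ρ β z L L L (L / 4) / wilsonFinTorusPartition ρ β L L L (L / 4)

/-- **`η`-THAWED at half-side `ℓ`**: `ℓ ≥ 8` and SOME nontrivial central temporal twist of the cold box `ℓ³ × ⌊ℓ∕4⌋` costs at most the fraction
`1 − η` (`r_z(β, ℓ) ≥ η`).  The landmark `ℓ_η(β)` of the line card is the least such `ℓ`. -/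
def ThawedAt (ρ : G →* Matrix (Fin N) (Fin N) ℂ) (β η : ℝ) (ℓ : ℕ) : Prop :=
  8 ≤ ℓ ∧ ∃ z : Fin 4 → G, IsCentralTwist z ∧ η ≤ twistRatio ρ β z ℓ

/-- **`η`-FROZEN BELOW `n`**: no `η`-thaw at any half-side `ℓ ≤ n` (the perturbative window of the line, read off the twists themselves). -/
def FrozenBelow (ρ : G →* Matrix (Fin N) (Fin N) ℂ) (β η : ℝ) (n : ℕ) : Prop :=
  ∀ ℓ : ℕ, ℓ ≤ n → ¬ ThawedAt ρ β η ℓ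

/-- A thaw at level `η` is a thaw at every lower level `η' ≤ η`. -/
theorem thawedAt_mono {ρ : G →* Matrix (Fin N) (Fin N) ℂ} {β η η' : ℝ} {ℓ : ℕ} (hη : η' ≤ η) (h : ThawedAt ρ β η ℓ) :
    ThawedAt ρ β η' ℓ := by
  obtain ⟨hℓ, z, hz, hr⟩ := h
  exact ⟨hℓ, z, hz, hη.trans hr⟩

/-- Frozen at level `η` below `n` implies frozen at every higher level `η' ≥ η` below every `n' ≤ n`. -/
theorem frozenBelow_mono {ρ : G →* Matrix (Fin N) (Fin N) ℂ} {β η η' : ℝ} {n n' : ℕ} (hη : η ≤ η') (hn : n' ≤ n)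
    (h : FrozenBelow ρ β η n) : FrozenBelow ρ β η' n' :=
  fun ℓ hℓ hth => h ℓ (hℓ.trans hn) (thawedAt_mono hη hth)

/-- `0 < r_z(β, L)` (both partition functions are positive). [parent B: `wilsonFinTorusTwistedPartition_pos`] -/
theorem twistRatio_pos [SecondCountableTopology G] {ρ : G →* Matrix (Fin N) (Fin N) ℂ} (hρ : Continuous ρ) (β : ℝ)
    (z : Fin 4 → G) (L : ℕ) : 0 < twistRatio ρ β z L := by
  unfold twistRatio
  have h1 := wilsonFinTorusTwistedPartition_pos ρ hρ β z L L L (L / 4)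
  have h2 := wilsonFinTorusTwistedPartition_pos ρ hρ β (1 : Fin 4 → G) L L L (L / 4)
  rw [wilsonFinTorusTwistedPartition_one] at h2
  exact div_pos h1 h2

/-- `r_z(β, L) ≤ 1` for central `z`, `β ≥ 0`, `L ≥ 8` — TWIST DOMINATION. [parent B: `TwistCost.twistedPartition_le`] -/
theorem twistRatio_le_one [SecondCountableTopology G] {ρ : G →* Matrix (Fin N) (Fin N) ℂ} (hρ : Continuous ρ)
    (hρu : ∀ g, ρ g ∈ Matrix.unitaryGroup (Fin N) ℂ) {β : ℝ} (hβ : 0 ≤ β) {L : ℕ} (hL : 8 ≤ L) {z : Fin 4 → G}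
    (hz : ∀ μ, z μ ∈ Subgroup.center G) : twistRatio ρ β z L ≤ 1 := by
  unfold twistRatio
  obtain ⟨m, hm⟩ : ∃ m : ℕ, L / 4 = m + 2 := ⟨L / 4 - 2, by omega⟩
  have h2 := wilsonFinTorusTwistedPartition_pos ρ hρ β (1 : Fin 4 → G) L L L (L / 4)
  rw [wilsonFinTorusTwistedPartition_one] at h2
  rw [div_le_one h2, hm]
  exact twistedPartition_le hρ hρu hβ L L L m hz

/-- **PURITY FORCES THAW (S1)**: a `θ`-pure cold box of half-side `L ≥ 8` is `(1 − 2θ)`-thawed (for EVERY nontrivial central twist; here: for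
the given one).  [parent B: `TwistCost.half_twist_cost_le_coldDefect`]  Consequence: in (EP) necessarily `T(η) ≥ 1` for `η ≤ 1 − 2θ`. -/
theorem thawedAt_of_pure [SecondCountableTopology G] {ρ : G →* Matrix (Fin N) (Fin N) ℂ} (hρ : Continuous ρ)
    (hρu : ∀ g, ρ g ∈ Matrix.unitaryGroup (Fin N) ℂ) {β θ : ℝ} (hβ : 0 ≤ β) {L : ℕ} (hL : 8 ≤ L)
    (hpure : coldDefect ρ β L ≤ θ) {z : Fin 4 → G} (hz : IsCentralTwist z) : ThawedAt ρ β (1 - 2 * θ) L := by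
  refine ⟨hL, z, hz, ?_⟩
  have h := (half_twist_cost_le_coldDefect hρ hρu hβ hL hz.1).1
  unfold twistRatio
  linarith

omit [TopologicalSpace G] [IsTopologicalGroup G] [CompactSpace G] [MeasurableSpace G] [BorelSpace G] in
/-- A group with no nontrivial central temporal twist datum has trivial centre (and conversely). [folklore] -/
theorem centre_trivial_of_no_twist (h : ¬ ∃ z : Fin 4 → G, IsCentralTwist z) :
    ∀ c : G, c ∈ Subgroup.center G → c = 1 := by
  intro c hc
  by_contra hne
  refine h ⟨Function.update 1 0 c, fun μ => ?_, ⟨0, ?_⟩⟩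
  · by_cases hμ : μ = 0
    · subst hμ; simpa using hc
    · rw [Function.update_of_ne hμ]; exact Subgroup.one_mem _
  · show Function.update (1 : Fin 4 → G) 0 c ((0 : Fin 3).castSucc) ≠ 1
    rw [show ((0 : Fin 3).castSucc : Fin 4) = 0 from rfl, Function.update_self]
    exact hne

end Vocabulary

section Covariance

variable (G : Type) [Group G] [TopologicalSpace G] [IsTopologicalGroup G] [CompactSpace G]
  [MeasurableSpace G] [BorelSpace G] (r : LatticeRep G)

/-- **Torus covariance of the action densities** at sites `x, y` (periodic lift to the torus of side `2S+1`) — the summand of the floor's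
`Q2 G r β S s f g = Σ_{x,y ∈ box S} f(s x) g(s y) · torusCov G r β S x y` (`rfl`). -/
def torusCov (β : ℝ) (S : ℕ) (x y : Site 4) : ℝ :=
  torusE G r β S (fun U => dens G r x U * dens G r y U) - torusE G r β S (dens G r x) * torusE G r β S (dens G r y)

/-- The floor's `Q2` is the test-function-weighted double sum of `torusCov` (definitional unfolding). -/
theorem Q2_eq_sum_torusCov (β : ℝ) (S : ℕ) (s : ℝ) (f g : 𝓢(EuclideanSpace ℝ (Fin 4), ℝ)) :
    Q2 G r β S s f g = ∑ x ∈ Literature.Probability.LatticeModels.box 4 S, ∑ y ∈ Literature.Probability.LatticeModels.box 4 S,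
      f (s • siteToE x) * g (s • siteToE y) * torusCov G r β S x y := rfl

end Covariance

/-! ## §1 The statements of the cut -/

/-- **PXcof(θ) = `PinnedExitsCofinalAt θ`** — VERBATIM the slot's first token (`Cruxes/IRcof/Lines/pinned_cofinal_bill.lean`). -/
def PinnedExitsCofinalAt (θ : ℝ) : Prop :=
  ∀ (G : Type) [Group G] [TopologicalSpace G] [IsTopologicalGroup G] [CompactSpace G],
    IsCompactSimpleLieGroup G → SimplyConnectedSpace G →
    letI : MeasurableSpace G := borel G
    haveI : BorelSpace G := ⟨rfl⟩
    ∀ (r : LatticeRep G) (a : ℝ → ℝ), (∀ β, 0 < a β) → Tendsto a atTop (𝓝 0) → LowerBounds G r a →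
      ∃ T : ℝ, ∀ β₁ : ℝ, ∃ β : ℝ, β₁ ≤ β ∧ ∃ L : ℕ, 8 ≤ L ∧ a β * (L : ℝ) ≤ T ∧ coldDefect r.ρ β L ≤ θ

/-- **(EP) `PureWithinLandmark θ` — PURITY WITHIN `T(η)` TWIST LANDMARKS, COFINALLY (floor-free, unit-free, Schwartz-free).**
For s.c. compact simple `G` admitting a nontrivial central temporal twist and every `r`: for every `η ∈ (0,1)` there is `T` such that for every
`β₁` SOME `β ≥ β₁` has a `θ`-pure cold `4:1` box of half-side `L ≥ 8` with `L ≤ T·ℓ` for EVERY `η`-thawed half-side `ℓ`.  Why it might fail: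
the purity scale outruns every fixed multiple of the first `η`-thaw along all large couplings for some `(G, r)` (asymptotic scaling of
`T_c ∕ Λ_{twisted scheme}` fails, or `m_{0⁺⁺}∕T_c → 0`), or deconfinement at `T = 0`.  Sources: 't Hooft 1979 §5; de Divitiis–Frezzotti–
Guagnelli–Petronzio NPB 422 (1994) (twisted running coupling); Lüscher–Sommer–Weisz–Wolff NPB 413 (1994) (`L_max∕L₀`); Fingberg–Heller–Karsch 1993. -/
def PureWithinLandmark (θ : ℝ) : Prop :=
  ∀ (G : Type) [Group G] [TopologicalSpace G] [IsTopologicalGroup G] [CompactSpace G],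
    IsCompactSimpleLieGroup G → SimplyConnectedSpace G → (∃ z : Fin 4 → G, IsCentralTwist z) →
    letI : MeasurableSpace G := borel G
    haveI : BorelSpace G := ⟨rfl⟩
    ∀ r : LatticeRep G, ∀ η : ℝ, 0 < η → η < 1 → ∃ T : ℝ, ∀ β₁ : ℝ, ∃ β : ℝ, β₁ ≤ β ∧
      ∃ L : ℕ, 8 ≤ L ∧ coldDefect r.ρ β L ≤ θ ∧ ∀ ℓ : ℕ, ThawedAt r.ρ β η ℓ → (L : ℝ) ≤ T * ℓ

/-- **(RW) `RunningWindow` — ASYMPTOTIC FREEDOM ON THE FROZEN WINDOW, in twisted-coupling form.**  For s.c. compact simple `G` with a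
nontrivial central twist and every `r`: `∃ K η₁ β₀`, for `β ≥ β₀` and `n ≥ 8`: if every cold box of half-side `≤ n` is `η₁`-frozen, then on every
large torus, at lags `n ≤ ‖y − x‖ ≤ 2n`, `|Cov(A_x, A_y)| · n⁸ ≤ K ∕ log²(r_z(β, n))` for some nontrivial central `z` (tree level: both sides
`≍ ḡ⁴(n)∕n⁸`).  Why it might fail: only if renormalised perturbation theory is NOT asymptotic uniformly on the window where the twisted coupling is
small (no such example is known; it is the Bałaban ∕ Magnen–Rivasseau–Sénéor programme's claim, unproved beyond finite tori).  Sources: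
Bałaban CMP 1985–89 (R4 `UV`); MRS 1993; Lüscher–Weisz 1985 (lattice PT of plaquette correlators); Di Giacomo–Rossi–(Meggiolaro) field-strength
correlators. -/
def RunningWindow : Prop :=
  ∀ (G : Type) [Group G] [TopologicalSpace G] [IsTopologicalGroup G] [CompactSpace G],
    IsCompactSimpleLieGroup G → SimplyConnectedSpace G → (∃ z : Fin 4 → G, IsCentralTwist z) →
    letI : MeasurableSpace G := borel G
    haveI : BorelSpace G := ⟨rfl⟩
    ∀ r : LatticeRep G, ∃ (K η₁ β₀ : ℝ), 0 < K ∧ 0 < η₁ ∧ η₁ < 1 ∧ ∀ β : ℝ, β₀ ≤ β → ∀ n : ℕ, 8 ≤ n →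
      FrozenBelow r.ρ β η₁ n → ∃ S₀ : ℕ, ∀ S : ℕ, S₀ ≤ S → ∀ x y : Site 4,
        (n : ℝ) ≤ ‖siteToE (y - x)‖ → ‖siteToE (y - x)‖ ≤ 2 * n →
          ∃ z : Fin 4 → G, IsCentralTwist z ∧
            |torusCov G r β S x y| * (n : ℝ) ^ 8 ≤ K / Real.log (twistRatio r.ρ β z n) ^ 2

/-- **(H) `HyperscalingEnvelope` — the soft envelope `|Cov_β(A_x, A_{x+w})| · ‖w‖⁸ ≤ C`**, all `w ≠ 0`, `β ≥ β₀`, all large tori (per `w`).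
No decay and no rate is claimed.  Why it might fail: only on an infrared-conformal window where the `F²` channel has dimension `< 4` (then
`‖w‖⁸ Cov → ∞` through the crossover); lattice artefacts at `‖w‖ ≤ 2` are absorbed in `C`.  Sources: OS-route item `MomentBounds` ∕ `FC2`
(hyperscaling `a⁴` per insertion, conditional); Di Giacomo–Panagopoulos PLB 285 (1992) (gluon-condensate correlator, bounded in physical units). -/
def HyperscalingEnvelope : Prop :=
  ∀ (G : Type) [Group G] [TopologicalSpace G] [IsTopologicalGroup G] [CompactSpace G],
    IsCompactSimpleLieGroup G → SimplyConnectedSpace G →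
    letI : MeasurableSpace G := borel G
    haveI : BorelSpace G := ⟨rfl⟩
    ∀ r : LatticeRep G, ∃ C β₀ : ℝ, ∀ β : ℝ, β₀ ≤ β → ∀ w : Site 4, w ≠ 0 →
      ∃ S₀ : ℕ, ∀ S : ℕ, S₀ ≤ S → ∀ x : Site 4, |torusCov G r β S x (x + w)| * ‖siteToE w‖ ^ 8 ≤ C

/-- **(J) `PinnedThaw` — THE FLOOR PINS A THAW: at every large coupling some cold box of half-side `ℓ ≤ R ∕ a(β)` is `η`-thawed.**
The conclusion of the junction lemma `pin_of_window : RunningWindow → HyperscalingEnvelope → PinnedThaw` (stub `stub_pin`, bookkeeping over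
parent family A); the floor `LowerBounds G r a` is consumed HERE and only here (honours `IRcof_false_without_LowerBounds`, p630186). -/
def PinnedThaw : Prop :=
  ∀ (G : Type) [Group G] [TopologicalSpace G] [IsTopologicalGroup G] [CompactSpace G],
    IsCompactSimpleLieGroup G → SimplyConnectedSpace G → (∃ z : Fin 4 → G, IsCentralTwist z) →
    letI : MeasurableSpace G := borel G
    haveI : BorelSpace G := ⟨rfl⟩
    ∀ (r : LatticeRep G) (a : ℝ → ℝ), (∀ β, 0 < a β) → Tendsto a atTop (𝓝 0) → LowerBounds G r a →
      ∃ (η R β₀ : ℝ), 0 < η ∧ η < 1 ∧ ∀ β : ℝ, β₀ ≤ β → ∃ ℓ : ℕ, ThawedAt r.ρ β η ℓ ∧ a β * (ℓ : ℝ) ≤ R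

/-- **(CF) `PinnedExitsCofinalCentreFreeAt θ` — PXcof VERBATIM on the CENTRE-FREE simply-connected simple groups (`G₂, F₄, E₈`)** — the same
declared residual token as row 42 (`deconfinement-ruler`); NECESSARY (restriction of PXcof). -/
def PinnedExitsCofinalCentreFreeAt (θ : ℝ) : Prop :=
  ∀ (G : Type) [Group G] [TopologicalSpace G] [IsTopologicalGroup G] [CompactSpace G],
    IsCompactSimpleLieGroup G → SimplyConnectedSpace G → (∀ z : G, z ∈ Subgroup.center G → z = 1) →
    letI : MeasurableSpace G := borel G
    haveI : BorelSpace G := ⟨rfl⟩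
    ∀ (r : LatticeRep G) (a : ℝ → ℝ), (∀ β, 0 < a β) → Tendsto a atTop (𝓝 0) → LowerBounds G r a →
      ∃ T : ℝ, ∀ β₁ : ℝ, ∃ β : ℝ, β₁ ≤ β ∧ ∃ L : ℕ, 8 ≤ L ∧ a β * (L : ℝ) ≤ T ∧ coldDefect r.ρ β L ≤ θ

end Summit.QuantumFields.YangMills.Cruxes.IRcof.RunningLandmark

end
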